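import Mathlib.Data.Real.Basic
import Mathlib.Algebra.Order.Field.Basic
import Mathlib.Tactic.Linarith
import Mathlib.Tactic.Positivity
import Mathlib.Tactic.Ring
import Mathlib.Tactic.FieldSimp
import HarnessLib
import Summits.CriticalPhenomena.PercolationContinuityZ3.Theorems.PercNearOneGluingNoHeavyLowerTailAPLVwAMGMAllEdge

/-!
# `NoHeavyLowerTail` (stmt-CriticalPhenomena-4575) — the GENERAL `(X, Y)` hypothesis-only step, the one-level deletion identity, and the cloudification identities

Support file (prover prim-ineq-gen-8 gen 50; `--supports stmt-CriticalPhenomena-4575`; memo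
run/shared/lean/prim/prim-ineq-gen-8/FINDING-gen50-XYFAMILY.md).  Pure real algebra: no definitions, no named facts, no sorries.

SETTING (gen-49 file `…APLVwAMGMAllEdge.lean`, memo FINDING-gen49-ALLEDGE.md §1).  Conditioning on ANY edge `e` (weight `p`,
`q = 1 − p`) of a finite weighted graph with apex and loads gives exact recursions `V = pV¹ + qV⁰ + pq a²` for the variance of the
apex-cluster load, `X = pX¹ + qX⁰ + pq x` (`x ≥ 0`) for every "concave" first-order functional `X` (`X = EL`: `x = 0`;
`X = F = Σ ℓ_z p_z(1−p_z)`: `x = c`; `X_t = EL − t Σ ℓ_z p_z²`: `x = t c`, see `interp_source_identity`), and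
`Y = pY¹ + qY⁰ + pq a b⁺` for `Y = C⁺ = 2|Cov(L,R)| − κ₃/3` (`b⁺ = b_D + ⅔(1+p)a² − 2Cov(L⁰,D) − 4M`).
THIS FILE [this work]:
* `xy_step`, `xy_step_degenerate` — the hypothesis-only induction step for the target `V² ≤ 2·X·Y` at an edge: if both children
  satisfy the target and the instance ratio `Θ = V/X` lies outside the edge's window, `x V² − 2a² V X + 2 a b⁺ X² ≥ 0`, then the
  parent satisfies the target.  (`X = EL, Y = C⁺`: the (Q0) step, one-level form `a V ≤ b⁺ EL` = (M⁺); `X = F, Y = C⁺`: the new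
  (Q0-F) step, one-level form (W-F⁺) `c Θ² − 2a²Θ + 2ab⁺ ≥ 0`, `Θ = V/F`.)  Assembled from the gen-49 window lemma
  `vf_step_window`; the degenerate case (`X⁰ = 0`, then `V⁰ = Y⁰ = 0`) is proved directly from `window_poly_identity`.
* `oneLevel_delete_identity` — for any edge: `EL·b⁺ − V·a = E⁰·b⁺ − V⁰·a + p a ((⅔ + 5p/3) a² − 4 Cov(L⁰,D) − 4M)`, i.e. the
  one-level inequality (M⁺) fails at `e` iff the `e`-DELETED instance has variance/mean ratio above `b⁺/a` (plus an explicit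
  correction): in a counterexample to (M⁺) deleting any boundary edge raises `V/EL` (memo §3).
* `interp_source_identity` — `X_t = Σ_z ℓ_z (p_z − t p_z²)` has the nonnegative source `t·pq(p¹_z − p⁰_z)²` per vertex.
* `cloud_core_identity`, `cloud_leaf_identity` — the two identities behind the CLOUDIFICATION REDUCTION (memo §2): replacing every
  load by a Poisson cloud of leaves of load `λ` sends `c → 0`, `b⁺ ↦ b⁺ + λa`, `Θ ↦ λ + V/EL` at core edges, so the (W-F⁺) window
  value of a core edge tends to `2a(b⁺ − a·V/EL)` (= the core's (M⁺) slack), while a leaf edge at `v` (`a = λp_v`, `c = λp_v²`,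
  `b⁺ = λ²p_v + ⅔(1+r)λ²p_v² − 2λN_v − 4λm_v`) has window value `λp_v²((Θ−λ)² + λ²) + (4/3)(1+r)λ³p_v³ − 4λ²p_v(N_v + 2m_v)`.
  Consequence: every member of the `(X_t, C⁺)` family of hypothesis-only methods reduces, under cloudification, to the single
  one-level inequality (M⁺) on the core (memo §2(c)).
-/

noncomputable section

namespace Summit.CriticalPhenomena.PercolationContinuityZ3.Theorems

namespace APL

/-! ### The general `(X, Y)` hypothesis-only step -/

/-- **General `(X,Y)` hypothesis-only step.**  `0 ≤ p ≤ 1`, `X¹, X⁰ > 0`, `x ≥ 0`; recursions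
`V = pV¹ + qV⁰ + pq a²`, `X = pX¹ + qX⁰ + pq x`, `Y = pY¹ + qY⁰ + pq a b⁺`; children satisfy `(Vⁱ)² ≤ 2 Xⁱ Yⁱ`; and the
instance lies outside the window of the edge: `x V² − 2a² V X + 2 a b⁺ X² ≥ 0`.  Then `V² ≤ 2 X Y`.
(`X = EL`, `x = 0`: the all-edge (Q0) step; `X = F`, `x = c`: the (Q0-F) step.) [this work] -/
theorem xy_step (p a x bplus V1 V0 X1 X0 Y1 Y0 V X Y : ℝ) (hp0 : 0 ≤ p) (hp1 : p ≤ 1)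
    (hX1 : 0 < X1) (hX0 : 0 < X0) (hx : 0 ≤ x)
    (hV : V = p * V1 + (1 - p) * V0 + p * (1 - p) * a ^ 2)
    (hX : X = p * X1 + (1 - p) * X0 + p * (1 - p) * x)
    (hY : Y = p * Y1 + (1 - p) * Y0 + p * (1 - p) * (a * bplus))
    (h1 : V1 ^ 2 ≤ 2 * X1 * Y1) (h0 : V0 ^ 2 ≤ 2 * X0 * Y0)
    (hwin : 0 ≤ x * V ^ 2 - 2 * a ^ 2 * V * X + 2 * a * bplus * X ^ 2) :
    V ^ 2 ≤ 2 * X * Y := by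
  have hstep := vf_step_window p a x bplus V1 V0 X1 X0 V X hp0 hp1 hX1 hX0 hx hV hX hwin
  have hq : 0 ≤ 1 - p := by linarith
  have hXnn : 0 ≤ X := by
    rw [hX]
    have e1 : 0 ≤ p * X1 := mul_nonneg hp0 hX1.le
    have e2 : 0 ≤ (1 - p) * X0 := mul_nonneg hq hX0.le
    have e3 : 0 ≤ p * (1 - p) * x := mul_nonneg (mul_nonneg hp0 hq) hx
    linarith
  have hd1 : V1 ^ 2 / X1 ≤ 2 * Y1 := by rw [div_le_iff₀ hX1]; linarith
  have hd0 : V0 ^ 2 / X0 ≤ 2 * Y0 := by rw [div_le_iff₀ hX0]; linarith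
  have hsum : p * (V1 ^ 2 / X1) + (1 - p) * (V0 ^ 2 / X0) + 2 * (p * (1 - p)) * a * bplus
      ≤ p * (2 * Y1) + (1 - p) * (2 * Y0) + 2 * (p * (1 - p)) * a * bplus := by
    have e1 := mul_le_mul_of_nonneg_left hd1 hp0
    have e2 := mul_le_mul_of_nonneg_left hd0 hq
    linarith
  have hmul := mul_le_mul_of_nonneg_left hsum hXnn
  have e : X * (p * (2 * Y1) + (1 - p) * (2 * Y0) + 2 * (p * (1 - p)) * a * bplus) = 2 * X * Y := by rw [hY]; ring
  linarith

/-- **Window form of the step with a degenerate child.**  If the `e`-deleted child is deterministic (`X⁰ = 0`, hence `V⁰ = 0`),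
`0 < p ≤ 1`, `X¹ > 0`, `x ≥ 0`, `V = pV¹ + pq a²`, `X = pX¹ + pq x`, and `x V² − 2a² V X + 2aβ X² ≥ 0`, then
`V² ≤ X (p (V¹)²/X¹ + 2pq aβ)`.  (Same polynomial identity as `vf_step_window`, no Cauchy–Schwarz needed.) [this work] -/
theorem vf_step_window_degenerate (p a x beta V1 X1 V X : ℝ) (hp0 : 0 < p) (hp1 : p ≤ 1) (hX1 : 0 < X1) (hx : 0 ≤ x)
    (hV : V = p * V1 + p * (1 - p) * a ^ 2) (hX : X = p * X1 + p * (1 - p) * x)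
    (hwin : 0 ≤ x * V ^ 2 - 2 * a ^ 2 * V * X + 2 * a * beta * X ^ 2) :
    V ^ 2 ≤ X * (p * (V1 ^ 2 / X1) + 2 * (p * (1 - p)) * a * beta) := by
  have hq : 0 ≤ 1 - p := by linarith
  have hpq : 0 ≤ p * (1 - p) := mul_nonneg hp0.le hq
  have hFbpos : 0 < p * X1 := mul_pos hp0 hX1
  have hXpos : 0 < X := by rw [hX]; have := mul_nonneg hpq hx; linarith
  have hid := window_poly_identity p a x (p * V1) (p * X1) V X (by rw [hV]) (by rw [hX])
  have hsq : 0 ≤ (p * (1 - p)) ^ 2 * (x * (p * V1) - a ^ 2 * (p * X1)) ^ 2 := by positivity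
  have hC : p * (1 - p) * (p * X1) * (2 * a ^ 2 * V * X - x * V ^ 2) ≤ p * (1 - p) * (p * X1) * (2 * a * beta * X ^ 2) :=
    mul_le_mul_of_nonneg_left (by linarith) (mul_nonneg hpq hFbpos.le)
  -- X (pX¹) V² ≤ X² (pV¹)² + pq (pX¹) 2aβ X²
  have key : X * (p * X1) * V ^ 2 ≤ X * (p * X1) * (X * (p * (V1 ^ 2 / X1) + 2 * (p * (1 - p)) * a * beta)) := by
    have e1 : X * (p * X1) * (X * (p * (V1 ^ 2 / X1) + 2 * (p * (1 - p)) * a * beta))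
        = X ^ 2 * (p * V1) ^ 2 + p * (1 - p) * (p * X1) * (2 * a * beta * X ^ 2) := by
      have hX1ne : X1 ≠ 0 := ne_of_gt hX1
      have hdiv : p * X1 * (p * (V1 ^ 2 / X1)) = p * p * V1 ^ 2 := by
        field_simp
      have hexp : X * (p * X1) * (X * (p * (V1 ^ 2 / X1) + 2 * (p * (1 - p)) * a * beta))
          = X ^ 2 * (p * X1 * (p * (V1 ^ 2 / X1))) + p * (1 - p) * (p * X1) * (2 * a * beta * X ^ 2) := by ring
      rw [hexp, hdiv]; ring
    rw [e1]
    nlinarith [hid, hsq, hC]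
  exact le_of_mul_le_mul_left key (mul_pos hXpos hFbpos)

/-- **General `(X,Y)` step with a degenerate child.**  `0 < p ≤ 1`, `X¹ > 0`, `x ≥ 0`, deleted child deterministic
(`V⁰ = X⁰ = 0`, `Y⁰ ≥ 0`), `(V¹)² ≤ 2X¹Y¹`, window condition as in `xy_step`.  Then `V² ≤ 2XY`. [this work] -/
theorem xy_step_degenerate (p a x bplus V1 X1 Y1 Y0 V X Y : ℝ) (hp0 : 0 < p) (hp1 : p ≤ 1)
    (hX1 : 0 < X1) (hx : 0 ≤ x) (hY0 : 0 ≤ Y0)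
    (hV : V = p * V1 + p * (1 - p) * a ^ 2) (hX : X = p * X1 + p * (1 - p) * x)
    (hY : Y = p * Y1 + (1 - p) * Y0 + p * (1 - p) * (a * bplus))
    (h1 : V1 ^ 2 ≤ 2 * X1 * Y1)
    (hwin : 0 ≤ x * V ^ 2 - 2 * a ^ 2 * V * X + 2 * a * bplus * X ^ 2) :
    V ^ 2 ≤ 2 * X * Y := by
  have hstep := vf_step_window_degenerate p a x bplus V1 X1 V X hp0 hp1 hX1 hx hV hX hwin
  have hq : 0 ≤ 1 - p := by linarith
  have hXnn : 0 ≤ X := by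
    rw [hX]
    have e1 : 0 ≤ p * X1 := mul_nonneg hp0.le hX1.le
    have e3 : 0 ≤ p * (1 - p) * x := mul_nonneg (mul_nonneg hp0.le hq) hx
    linarith
  have hd1 : V1 ^ 2 / X1 ≤ 2 * Y1 := by rw [div_le_iff₀ hX1]; linarith
  have hsum : p * (V1 ^ 2 / X1) + 2 * (p * (1 - p)) * a * bplus
      ≤ p * (2 * Y1) + (1 - p) * (2 * Y0) + 2 * (p * (1 - p)) * a * bplus := by
    have e1 := mul_le_mul_of_nonneg_left hd1 hp0.le
    have e2 : 0 ≤ (1 - p) * (2 * Y0) := mul_nonneg hq (by linarith)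
    linarith
  have hmul := mul_le_mul_of_nonneg_left hsum hXnn
  have e : X * (p * (2 * Y1) + (1 - p) * (2 * Y0) + 2 * (p * (1 - p)) * a * bplus) = 2 * X * Y := by rw [hY]; ring
  linarith

/-! ### The interpolating functionals `X_t = EL − t Σ ℓ p²` -/

/-- **Source of `X_t` at one vertex.**  With `p̄ = p p¹ + q p⁰` (the vertex's connection probability as a mixture over the
edge), `(p̄ − t p̄²) − p(p¹ − t(p¹)²) − q(p⁰ − t(p⁰)²) = t·pq(p¹ − p⁰)²` — nonnegative for `t ≥ 0`; summed against the loads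
this is the recursion `X_t = pX_t¹ + qX_t⁰ + pq·t c`. [this work] -/
theorem interp_source_identity (p t p1 p0 : ℝ) :
    ((p * p1 + (1 - p) * p0) - t * (p * p1 + (1 - p) * p0) ^ 2) - p * (p1 - t * p1 ^ 2) - (1 - p) * (p0 - t * p0 ^ 2)
      = t * (p * (1 - p)) * (p1 - p0) ^ 2 := by
  ring

/-! ### The one-level deletion identity -/

/-- **One-level deletion identity (any edge).**  With the recursions `V = pV¹ + qV⁰ + pq a²`, `EL = E⁰ + p a`,
`V¹ − V⁰ = b_D − a² + 2·Cov(L⁰,D)` and `b⁺ = b_D + ⅔(1+p)a² − 2Cov(L⁰,D) − 4M`: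
`EL·b⁺ − V·a = E⁰·b⁺ − V⁰·a + p·a·((⅔ + 5p/3)a² − 4Cov(L⁰,D) − 4M)`.
So (M⁺) fails at the edge iff the `e`-deleted instance has `V⁰/E⁰` above `b⁺/a` by more than the explicit correction; at a
boundary edge (`M = 0`, `Cov(L⁰,D) ≤ 0`) the correction is nonnegative, hence failure forces `V⁰/E⁰ > b⁺/a` and `V/EL < V⁰/E⁰`
(memo §3(a)). [this work] -/
theorem oneLevel_delete_identity (p a bD cov M V1 V0 E0 V EL bplus : ℝ)
    (hV : V = p * V1 + (1 - p) * V0 + p * (1 - p) * a ^ 2) (hV1 : V1 = V0 + bD - a ^ 2 + 2 * cov)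
    (hEL : EL = E0 + p * a) (hb : bplus = bD + (2 / 3) * (1 + p) * a ^ 2 - 2 * cov - 4 * M) :
    EL * bplus - V * a = E0 * bplus - V0 * a + p * a * ((2 / 3 + 5 * p / 3) * a ^ 2 - 4 * cov - 4 * M) := by
  rw [hV, hV1, hEL, hb]; ring

/-- **Mediant form.**  Under the same recursions, `V = V⁰ + p·(b_D − p a² + 2Cov(L⁰,D))` and `EL = E⁰ + p a`: the root ratio
`V/EL` is the mediant of `V⁰/E⁰` and `s/a` with `s = b_D − p a² + 2Cov(L⁰,D)`, and `b⁺ − s = (⅔ + 5p/3)a² − 4Cov(L⁰,D) − 4M`.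
[this work] -/
theorem oneLevel_mediant_identity (p a bD cov M V1 V0 V bplus : ℝ)
    (hV : V = p * V1 + (1 - p) * V0 + p * (1 - p) * a ^ 2) (hV1 : V1 = V0 + bD - a ^ 2 + 2 * cov)
    (hb : bplus = bD + (2 / 3) * (1 + p) * a ^ 2 - 2 * cov - 4 * M) :
    V = V0 + p * (bD - p * a ^ 2 + 2 * cov)
      ∧ bplus - (bD - p * a ^ 2 + 2 * cov) = (2 / 3 + 5 * p / 3) * a ^ 2 - 4 * cov - 4 * M := by
  refine ⟨?_, ?_⟩
  · rw [hV, hV1]; ring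
  · rw [hb]; ring

/-! ### Cloudification identities -/

/-- **Core edge under cloudification.**  In the Poisson-cloud limit a core edge keeps `a`, gets `b⁺ + λa`, loses `c`, and the
instance ratio becomes `Θ = λ + T` (`T = V/EL` of the core): the window value is `2a(b⁺ − aT)`, λ-free — the core's (M⁺)
slack at that edge. [this work] -/
theorem cloud_core_identity (a bplus lam T : ℝ) :
    0 * (lam + T) ^ 2 - 2 * a ^ 2 * (lam + T) + 2 * a * (bplus + lam * a) = 2 * a * (bplus - a * T) := by
  ring

/-- **Leaf edge under cloudification.**  A pendant leaf of load `λ` attached with rate `r` to a vertex `v` with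
`P(v ∈ K) = P`, `N = Cov(L⁰, 1[v∈K]) ≥ 0`, `m = E[ℓ(C(v)); v ∉ K] ≥ 0` has `a = λP`, `c = λP²`,
`b⁺ = λ²P + ⅔(1+r)λ²P² − 2λN − 4λm`, and its window value at ratio `Θ` is
`λP²((Θ − λ)² + λ²) + (4/3)(1+r)λ³P³ − 4λ²P(N + 2m)`: the leaf edge fails (W-F⁺) iff
`N + 2m > P((Θ−λ)² + λ²)/(4λ) + ⅓(1+r)λP²` (memo §2(b)). [this work] -/
theorem cloud_leaf_identity (lam P r N m T : ℝ) :
    (lam * P ^ 2) * T ^ 2 - 2 * (lam * P) ^ 2 * T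
        + 2 * (lam * P) * (lam ^ 2 * P + (2 / 3) * (1 + r) * lam ^ 2 * P ^ 2 - 2 * lam * N - 4 * lam * m)
      = lam * P ^ 2 * ((T - lam) ^ 2 + lam ^ 2) + (4 / 3) * (1 + r) * lam ^ 3 * P ^ 3 - 4 * lam ^ 2 * P * (N + 2 * m) := by
  ring

end APL

end Summit.CriticalPhenomena.PercolationContinuityZ3.Theorems
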